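/-
Copyright (c) 2026 the pub-hodgecm-mathlib formalisation cell (harness21).  Prover seat hodgecm-mathlib-LH4-p10 (g0), req620 Track A «(D-RAM) FOUR-FRAME» squad
(unit U3_Laws, stubs `stub_U3_stableLaw_RP ∕ _RU`; LH4-p11 (g0) (S)-side TARGET D «SUB-BUILDING SLOT NORMALISATION», signature of 2026-09-03 22:05:13Z verbatim).  2026-09-03.
-/
import Literature.NumberTheory.Automorphic.UnitaryLatticeTreeTypes    -- ★ (B-p14): `le_dualLatt_of_isVertexLattice`, `scaleLattice_dualLatt_le_of_isVertexLattice`, `mem_scaleLattice_iff`; brings ★ `UnitaryLatticeTreeDual` (`mem_dualLatt`, `mulVec_single_mem_latt`)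
import HarnessLib

/-!
# Crux `H413`, line LH4 «(D-RAM) FOUR-FRAME» road — unit U3_Laws (iii), TIER 2 SUPPORT: SUB-BUILDING SLOT NORMALISATION in the unimodular diagonal model
# (for a vertex lattice split at slot `i`, the `i`-th coordinate lattice is exactly `𝒪·e_i`)

Cell `hodgecm-mathlib` (D-0151), FLOOR 0, crux item H413 = `stmt-HodgeConjecture-24833`, route of record `HCCMUnconditional`; squad F0∕P3c∕LH4 (req618∕req620).  THEOREMS ONLY
(no `def`, no instance, no notation, no `sorry`, default heartbeats); lane `--supports stmt-HodgeConjecture-24833 --as helper` (count-neutral).  This is LH4-p11 (g0)'s (S)-side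
TARGET D, typed by LH4-p10 (g0); same currency as ★ p855032 ∕ p855052 ∕ p855091 ∕ p855126 (unit diagonal form `diag(d)`, `|d_i| = 1`, coordinate idempotents via `Pi.single`).

WHAT IS PROVED.  Let `(K, |·|)` be `ℤᵐ⁰`-valued, `σ` valuation-preserving, `|ϖ| = exp(−1)`, `h_d = diag(d)` a UNIT diagonal form (`|d_i| = 1`), and `M` a vertex lattice of
`(K³, h_d)` of any type `t` (★ `IsVertexLattice`: `ϖM^♯ ≤ M ≤ M^♯`).  If `M` is SPLIT AT THE SLOT `i` — `x ∈ M ⇒ x_i e_i ∈ M` (i.e. `π_i M ≤ M`, `M` lies on the split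
sub-building `B_i` of the slot) — then `e_i ∈ M` and every `x ∈ M` has `|x_i| ≤ 1`; so the `i`-th coordinate lattice of `M` is EXACTLY `𝒪·e_i` and `M = 𝒪e_i ⊕ (M ∩ e_i^⊥)`
(`single_mem_and_v_le_of_isVertexLattice_diagonal`).  MEANING for the census of the STABLE LAW (S) (LH4-p11 DATUM §5, LH4-p10 MEMO-stableLaw-finite): along `B_i` the
vertices are `𝒪e_i ⊕ (plane vertex)`, so `B_i ≅` the rank-2 lattice tree of the plane `(K², diag(d_j, d_k))` — the entry point of the plane census; with TARGET C (all three slots)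
the only totally split vertex is the core `𝒪³`.

THE MATHEMATICS ([Jacobowitz1962, §4, §7]; [BruhatTits1972, §10]; [Serre1980Trees, II §1.1]).  Write `M = g·𝒪³`.  The `i`-th coordinates of `M` form the fractional ideal generated
by the `i`-th row of `g`; let `a = g_{i j₀}` be an entry of that row of MAXIMAL absolute value (`a ≠ 0` since `g` is invertible), attained by the column `x₀ = g e_{j₀} ∈ M`, so
`|x_i| ≤ |a|` on `M` and `a e_i ∈ M` (splitting).  (1) `M ≤ M^♯`: for `x ∈ M`, `x_i e_i ∈ M` pairs integrally with itself, `|σ(x_i) d_i x_i| = |x_i|² ≤ 1`, so `|x_i| ≤ 1`.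
(2) `ϖM^♯ ≤ M`: the vector `y = (σ(a) d_i)⁻¹ e_i` pairs with `m ∈ M` to `σ(m_i)∕σ(a)`, of absolute value `≤ 1`, so `y ∈ M^♯` and `ϖ y ∈ M`; its `i`-th coordinate gives
`|ϖ|∕|a| ≤ |a|`, i.e. `exp(−1) ≤ |a|²`.  With `|a| ≤ 1` and `|a| ∈ exp(ℤ)` this forces `|a| = 1`, and `e_i = a⁻¹·(a e_i) ∈ M`.
* §1 `pairing_diagonal_single_right` (`⟨x, c e_i⟩_{diag d} = σ(x_i) d_i c`), `eq_one_of_exp_neg_one_le_mul_self` (the `ℤᵐ⁰` bookkeeping).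
* §2 the head `single_mem_and_v_le_of_isVertexLattice_diagonal`.
HONEST LABEL.  Count-neutral (`--supports`); nothing printed is asserted; the census laws stay PROVER TARGETS; the verdict of record for (D-RAM) stays PRINT
[LanglandsShelstad1989 Thm. p. 484 ∕ Rogawski1990 Prop. 4.9.1 (a)] ∕ XL; `HC_CM` is proved only modulo the 7 printed citations (2 remaining named inputs: hLiu418 =
`stmt-HodgeConjecture-24832`, h413 = `stmt-HodgeConjecture-24833`) until rung 0 closes.

## References
* [Jacobowitz1962] R. Jacobowitz, *Hermitian forms over local fields*, Amer. J. Math. 84 (1962), §4 (Gram matrices, duals), §7 (unimodular lattices, orthogonal splitting).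
* [BruhatTits1972] F. Bruhat, J. Tits, *Groupes réductifs sur un corps local I*, Publ. Math. IHÉS 41 (1972), §10 (lattice model of the building of a unitary group; sub-buildings of Levi subgroups).
* [Serre1980Trees] J.-P. Serre, *Trees* (1980), Ch. II §1.1 (lattices and the tree).
* [Rogawski1990] J. D. Rogawski, *Automorphic Representations of Unitary Groups in Three Variables*, Ann. of Math. Stud. 123 (1990), §4.9 Prop. 4.9.1 (a) p. 55 (orbital integrals as fixed-lattice counts).
-/

set_option autoImplicit false

noncomputable section

namespace Summit.HodgeConjecture.HodgeConjecture.Cruxes.H413.F0P3cDyRamDiagonalSubBuildingSlot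

open Matrix
open Literature.NumberTheory.Automorphic Literature.NumberTheory.Automorphic.HermitianLattice Literature.NumberTheory.Automorphic.UnitaryGroup
open Literature.NumberTheory.Automorphic.UnitaryLatticeTree
open scoped Valued WithZero Matrix MatrixGroups

/-! ## §1  The pairing against a coordinate vector, and a `ℤᵐ⁰` inequality -/

section Prelim

variable {K : Type*} [Field K]

/-- `⟨x, c·e_i⟩_{diag(d)} = σ(x_i)·d_i·c` (★ `pairing_apply`). [cite: Jacobowitz1962, §4] -/
theorem pairing_diagonal_single_right (σ : K →+* K) (d : Fin 3 → K) (x : Fin 3 → K) (i : Fin 3) (c : K) :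
    pairing σ (Matrix.diagonal d) x (Pi.single i c) = σ (x i) * d i * c := by
  rw [pairing_apply]
  rw [Finset.sum_eq_single i (fun k _ hk => ?_) (fun h => absurd (Finset.mem_univ i) h)]
  · rw [Finset.sum_eq_single i (fun j _ hj => ?_) (fun h => absurd (Finset.mem_univ i) h)]
    · rw [Matrix.diagonal_apply_eq, Pi.single_eq_same]
    · rw [Pi.single_eq_of_ne hj, mul_zero]
  · refine Finset.sum_eq_zero fun j _ => ?_
    by_cases hkj : k = j
    · subst hkj; rw [Pi.single_eq_of_ne hk, mul_zero]
    · rw [Matrix.diagonal_apply_ne _ hkj, mul_zero, zero_mul]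

/-- In `ℤᵐ⁰`: `exp(−1) ≤ a·a` and `a ≤ 1` force `a = 1` (there is no value strictly between `exp(−1)` and `exp(0)`). [cite: Serre1980Trees, II §1.1] -/
theorem eq_one_of_exp_neg_one_le_mul_self {a : ℤᵐ⁰} (h1 : WithZero.exp (-1 : ℤ) ≤ a * a) (h2 : a ≤ 1) : a = 1 := by
  rcases eq_or_ne a 0 with rfl | ha
  · rw [mul_zero] at h1
    exact absurd h1 (not_le.2 (WithZero.exp_pos (a := (-1 : ℤ))))
  · obtain ⟨u, rfl⟩ := WithZero.ne_zero_iff_exists.1 ha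
    rw [← WithZero.coe_mul, WithZero.exp, WithZero.coe_le_coe] at h1
    rw [← WithZero.coe_one, WithZero.coe_le_coe] at h2
    rw [← WithZero.coe_one, WithZero.coe_inj]
    have h1' := Multiplicative.toAdd_le.2 h1
    have h2' := Multiplicative.toAdd_le.2 h2
    rw [toAdd_mul, toAdd_ofAdd] at h1'
    rw [toAdd_one] at h2'
    have : Multiplicative.toAdd u = 0 := by omega
    exact Multiplicative.toAdd.injective (by rw [this, toAdd_one])

end Prelim

/-! ## §2  The head -/

section Head

/-- **HEAD — SUB-BUILDING SLOT NORMALISATION.**  For `σ` valuation-preserving, `|ϖ| = exp(−1)`, a unit diagonal form `diag(d)` (`|d_i| = 1`) and a vertex lattice `M` of `(K³, diag d)`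
of any type `t` which is split at the slot `i` (`x ∈ M ⇒ x_i e_i ∈ M`): `e_i ∈ M` and `|x_i| ≤ 1` for all `x ∈ M` — the `i`-th coordinate lattice of `M` is exactly `𝒪 e_i`.
(1) `M ≤ M^♯` bounds `|x_i|² ≤ 1`; (2) `ϖM^♯ ≤ M` applied to `y = (σ(a) d_i)⁻¹ e_i ∈ M^♯`, `a` an `i`-th coordinate of maximal absolute value, gives `exp(−1) ≤ |a|²`, whence `|a| = 1`.
[cite: Jacobowitz1962, §4, §7] [cite: BruhatTits1972, §10] [cite: Serre1980Trees, II §1.1] [cite: Rogawski1990, §4.9 Prop. 4.9.1 (a) p. 55] -/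
theorem single_mem_and_v_le_of_isVertexLattice_diagonal {K : Type*} [Field K] [Valued K ℤᵐ⁰] {σ : K →+* K}
    (hvσ : ∀ a, Valued.v (σ a) = Valued.v a) {ϖ : K} (hϖ : Valued.v ϖ = WithZero.exp (-1 : ℤ)) {d : Fin 3 → K} (hd : ∀ i, Valued.v (d i) = 1)
    {t : ℕ} {M : Submodule 𝒪[K] (Fin 3 → K)} (hM : IsVertexLattice σ ϖ (Matrix.diagonal d) t M) (i : Fin 3)
    (hi : ∀ x ∈ M, (Pi.single i (x i) : Fin 3 → K) ∈ M) :
    (Pi.single i 1 : Fin 3 → K) ∈ M ∧ ∀ x ∈ M, Valued.v (x i) ≤ 1 := by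
  classical
  have hϖ0 : ϖ ≠ 0 := fun h => by rw [h, map_zero] at hϖ; exact WithZero.zero_ne_coe hϖ
  have hd0 : ∀ k, d k ≠ 0 := fun k h => by have := hd k; rw [h, map_zero] at this; exact zero_ne_one this
  have hH : IsUnit (Matrix.diagonal d).det := by
    rw [Matrix.det_diagonal, isUnit_iff_ne_zero]
    exact Finset.prod_ne_zero_iff.2 fun k _ => hd0 k
  -- the two vertex inclusions
  have hle : M ≤ dualLatt σ (Matrix.diagonal d) M := le_dualLatt_of_isVertexLattice hvσ hM
  have hϖle : scaleLattice ϖ (dualLatt σ (Matrix.diagonal d) M) ≤ M := scaleLattice_dualLatt_le_of_isVertexLattice hvσ hH hM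
  -- (1) every `i`-th coordinate is integral
  have hint : ∀ x ∈ M, Valued.v (x i) ≤ 1 := by
    intro x hx
    have hy := hi x hx
    have hyy := (mem_dualLatt σ (Matrix.diagonal d) M _).1 (hle hy) _ hy
    rw [pairing_diagonal_single_right, Pi.single_eq_same, map_mul, map_mul, hvσ, hd i, mul_one] at hyy
    exact le_of_not_gt fun hlt => absurd hyy (not_le.2 (one_lt_mul'' hlt hlt))   -- `|x_i|² ≤ 1 ⇒ |x_i| ≤ 1` (cf. ★ `UnitaryLatticeTree.le_one_of_mul_self_le_one`)
  refine ⟨?_, hint⟩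
  -- the frame `g` of `M` and an `i`-th coordinate `a = g i j₀` of maximal absolute value
  obtain ⟨g, hMg, -, -, -⟩ := hM
  obtain ⟨j₀, -, hj₀⟩ := Finset.exists_max_image Finset.univ (fun j => Valued.v ((g : Matrix (Fin 3) (Fin 3) K) i j)) Finset.univ_nonempty
  set a : K := (g : Matrix (Fin 3) (Fin 3) K) i j₀ with ha_def
  -- `|x_i| ≤ |a|` on `M`
  have hmax : ∀ x ∈ M, Valued.v (x i) ≤ Valued.v a := by
    intro x hx
    rw [hMg, latt, Submodule.mem_map] at hx
    obtain ⟨u, hu, rfl⟩ := hx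
    change Valued.v (((g : Matrix (Fin 3) (Fin 3) K).mulVec u) i) ≤ Valued.v a
    rw [Matrix.mulVec, dotProduct]
    refine Valuation.map_sum_le _ fun j _ => ?_
    rw [map_mul]
    calc Valued.v ((g : Matrix (Fin 3) (Fin 3) K) i j) * Valued.v (u j)
        ≤ Valued.v ((g : Matrix (Fin 3) (Fin 3) K) i j) * 1 := mul_le_mul' le_rfl (mem_stdLattice.1 hu j)
      _ ≤ Valued.v a := by rw [mul_one]; exact hj₀ j (Finset.mem_univ j)
  -- `a ≠ 0`: otherwise the `i`-th row of `g` vanishes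
  have ha0 : a ≠ 0 := by
    intro ha
    have hrow : ∀ j, (g : Matrix (Fin 3) (Fin 3) K) i j = 0 := fun j => by
      have := hj₀ j (Finset.mem_univ j)
      rw [ha, map_zero, le_zero_iff] at this
      exact (Valuation.zero_iff _).1 this
    have hdet : (g : Matrix (Fin 3) (Fin 3) K).det = 0 := Matrix.det_eq_zero_of_row_eq_zero i hrow
    exact (Matrix.isUnits_det_units g).ne_zero hdet
  have hva0 : Valued.v a ≠ 0 := (Valuation.ne_zero_iff _).2 ha0
  have hσa0 : σ a ≠ 0 := (map_ne_zero σ).2 ha0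
  -- `a e_i ∈ M` (the column `g e_{j₀}` lies in `M`, then split at `i`)
  have hx₀ : (g : Matrix (Fin 3) (Fin 3) K).mulVec (Pi.single j₀ 1) ∈ M := by rw [hMg]; exact mulVec_single_mem_latt _ j₀
  have hae : (Pi.single i a : Fin 3 → K) ∈ M := by
    have := hi _ hx₀
    rwa [Matrix.mulVec_single_one, Matrix.col_apply] at this
  -- (1) at `a`: `|a| ≤ 1`
  have ha1 : Valued.v a ≤ 1 := by simpa only [Pi.single_eq_same] using hint _ hae
  -- (2) `y = (σ a · d_i)⁻¹ e_i ∈ M^♯`, so `ϖ y ∈ M`, so `|ϖ|∕|a| ≤ |a|`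
  have hy : (Pi.single i ((σ a * d i)⁻¹) : Fin 3 → K) ∈ dualLatt σ (Matrix.diagonal d) M := by
    rw [mem_dualLatt]
    intro m hm
    rw [pairing_diagonal_single_right, mul_inv, ← mul_assoc, mul_assoc (σ (m i)), mul_comm (d i), ← mul_assoc, mul_assoc _ (d i),
      mul_inv_cancel₀ (hd0 i), mul_one, map_mul, map_inv₀, hvσ, hvσ]
    calc Valued.v (m i) * (Valued.v a)⁻¹ ≤ Valued.v a * (Valued.v a)⁻¹ := mul_le_mul' (hmax m hm) le_rfl
      _ = 1 := mul_inv_cancel₀ hva0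
  have hϖy : (ϖ • (Pi.single i ((σ a * d i)⁻¹) : Fin 3 → K)) ∈ M := by
    refine hϖle ((mem_scaleLattice_iff hϖ0 _ _).2 ?_)
    rwa [smul_smul, inv_mul_cancel₀ hϖ0, one_smul]
  have h2 : WithZero.exp (-1 : ℤ) ≤ Valued.v a * Valued.v a := by
    have := hmax _ hϖy
    rw [Pi.smul_apply, Pi.single_eq_same, smul_eq_mul, map_mul, map_inv₀, map_mul, hvσ, hd i, mul_one, hϖ] at this
    calc WithZero.exp (-1 : ℤ) = WithZero.exp (-1 : ℤ) * (Valued.v a)⁻¹ * Valued.v a := by rw [mul_assoc, inv_mul_cancel₀ hva0, mul_one]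
      _ ≤ Valued.v a * Valued.v a := mul_le_mul' this le_rfl
  have hva : Valued.v a = 1 := eq_one_of_exp_neg_one_le_mul_self h2 ha1
  -- `e_i = a⁻¹ · (a e_i) ∈ M`
  have hainv : Valued.v a⁻¹ ≤ 1 := by rw [map_inv₀, hva, inv_one]
  have hmem := M.smul_mem (⟨a⁻¹, hainv⟩ : 𝒪[K]) hae
  have heq : ((⟨a⁻¹, hainv⟩ : 𝒪[K]) • (Pi.single i a : Fin 3 → K)) = Pi.single i 1 := by
    change (a⁻¹ : K) • (Pi.single i a : Fin 3 → K) = Pi.single i 1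
    rw [← Pi.single_smul, smul_eq_mul, inv_mul_cancel₀ ha0]
  rwa [heq] at hmem

end Head

end Summit.HodgeConjecture.HodgeConjecture.Cruxes.H413.F0P3cDyRamDiagonalSubBuildingSlot

end
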